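import Summits.QuantumFields.YangMills.Theorems.BalabanLadderNTClassicalShadowOrbit
import HarnessLib

/-!
# Crux `NT` (stmt-QuantumFields-19353), stub `stub_refpkgT : RefPkgT`: THE CLASSICAL SHADOW, VI — the BOUNDARY LAYER is in scope:
# every zero-temperature test of clauses 1–3 holds at the registered typing `1 ≤ depth`

Helper file (`--supports stmt-QuantumFields-19353`) of the fleet lead prover of crux `NT` (unit `ym-spine-19353-p1`, GEN 15); sequel of
`…NTClassicalShadow` (p598990) and `…NTClassicalShadowOrbit` (p601276).

WHY.  The registered clauses 1–3 of `RefPkgT` are typed at `1 ≤ depth`: they constrain the cube kernels at EVERY site of the cube,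
boundary layer (depth `1`) included.  All zero-temperature consequences landed so far (`tendsto_kerCov_one_dens`,
`zeroTemp_kerCov_le_of_e2osc`, the orbit test `orbitCov_le_of_e2osc`, …) ask `2 ≤ depth`, only because the flatness lemma for the
identity exterior (`dens_eq_dens_one_of_mem_cubeMinimisers_one`, disprover lane) was proved through «the plaquettes based at `x`
touch the cube», which needs depth `≥ 2`.  The restriction is an artefact: a plaquette that does NOT touch the cube reads only
exterior links, which the identity exterior sets to `1`, so it is flat as well.  Hence:

* §1 `plaquetteObs_eq_N_of_isMinOn_one_all` — in a ground state of ANY finite link set `Λ` glued into the identity exterior, EVERY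
  plaquette of `ℤ⁴` has `Re tr r.ρ(U_p) = N`; `dens_eq_dens_one_of_mem_cubeMinimisers_one_all` — the action density of such a ground
  state equals its flat value `dens x 1 = 6N` at EVERY site `x` (no depth hypothesis);
* §2 the identity-exterior references at every site: `tendsto_kerE_one_dens_all` (`→ 6N`), `tendsto_kerE_one_dens_mul_all`,
  **`tendsto_kerCov_one_dens_all` (`→ 0`)**, `tendsto_kerE_one_dens_mul_mul_all`, **`tendsto_kerK3_one_all` (`→ 0`)**;
* §3 clauses 2–3 at `β = ∞` ON THE BOUNDARY LAYER: **`zeroTemp_kerCov_le_of_e2osc_depthOne`**, `zeroTemp_kerK3_le_of_e3osc_depthOne`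
  (sites of depth `≥ 1`, i.e. every cube site, envelope with `min depth = 1` allowed);
* §4 the ORBIT TEST on the boundary layer: **`orbitCov_le_of_e2osc_depthOne`** (`C₂ ≥ min d⁴(1+‖y−x‖)⁴·|Cov_Γ|` for symmetry-related
  sites of depth `≥ 1`), `orbitVar_le_of_e2osc_depthOne`, `orbitMean_deficit_le_of_e1osc_depthOne`.

NUMBERS (memo SIZING-19353-g15 §2).  In the classical programme's frustrated `SU(2)` boxes (lead g14, kit j298039/j298223/j298346/j298557)
the symmetry-breaking contrast of the corner density is LARGEST on the boundary layer (swap contrast `1.3–3.5` at depth `1` against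
`0.04–0.135` at depth `2`), so the depth-1 orbit floors `(1+n)⁴·|Cov_Γ|` exceed the depth-2 floors `16(1+n)⁴·|Cov_Γ|` reported there
whenever the boundary-layer orbit covariance exceeds `16×` the depth-2 one — the registered typing makes these sites admissible.

HONEST FRAMING.  Consequences of the registered clauses at fixed lattice geometry as `β → ∞`; necessary conditions on instances; the
kernel symmetry and one-orbit hypotheses of §4 are hypotheses exactly as in `…ClassicalShadowOrbit`; nothing here asserts that any
exterior violates the clauses; no floor, not AF, not NT, not the seam, not the gap; not Clay.
-/

set_option autoImplicit false

noncomputable section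

open MeasureTheory Filter Topology
open Literature.MathematicalPhysics.QuantumFieldTheory Literature.MathematicalPhysics.QuantumLattice
open Literature.Probability.LatticeModels
open Summit.QuantumFields.YangMills.Cruxes.OSLegsFromFemtoAndGap.DlrCollarTransfer
open Summit.QuantumFields.YangMills.Cruxes.UVSeamRec.BoundaryLawPenetration
open Summit.QuantumFields.YangMills.Cruxes.NT.BoundaryLaw (plane_eq_plaquetteObs)

namespace Summit.QuantumFields.YangMills.Cruxes.NT.ClassicalShadow

variable {G : Type} [Group G] [TopologicalSpace G] [IsTopologicalGroup G] [CompactSpace G]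
  [MeasurableSpace G] [BorelSpace G] (r : LatticeRep G)

/-! ## §1 The identity exterior is flat at EVERY plaquette of a ground state -/

omit [IsTopologicalGroup G] [CompactSpace G] [MeasurableSpace G] [BorelSpace G] in
/-- **Ground states with identity exterior are flat everywhere.**  If `ζ` minimises the boundary Wilson action of the finite link set
`Λ` glued into the identity configuration, then EVERY plaquette `p` of `ℤ⁴` has `Re tr r.ρ(U_p) = N` in `glueWith Λ ζ 1`: a plaquette
touching `Λ` by `plaquetteObs_eq_N_of_isMinOn_one`, a plaquette not touching `Λ` because it reads four exterior links, all `= 1`.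
[folklore] -/
theorem plaquetteObs_eq_N_of_isMinOn_one_all {Λ : Finset (Literature.MathematicalPhysics.QuantumLattice.ZdEdge 4)} {ζ : ↥Λ → G}
    (hζ : ∀ ζ' : ↥Λ → G, wilsonBoundaryAction r.ρ Λ (glueWith Λ ζ 1) ≤ wilsonBoundaryAction r.ρ Λ (glueWith Λ ζ' 1))
    (p : ZdPlaquette 4) :
    plaquetteObs r.ρ p.1 p.2.1.1 p.2.1.2 (glueWith Λ ζ 1) = r.N := by
  by_cases hp : p ∈ plaquettesTouching Λ
  · exact plaquetteObs_eq_N_of_isMinOn_one r hζ hp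
  · have h : ∀ e ∈ plaquetteEdges p, glueWith Λ ζ (1 : LGConfig 4 G) e = (1 : LGConfig 4 G) e := by
      intro e he
      have heΛ : e ∉ Λ := fun heΛ => hp (mem_plaquettesTouching_iff.2 ⟨e, Finset.mem_inter.2 ⟨he, heΛ⟩⟩)
      exact glueWith_apply_not_mem Λ ζ 1 heΛ
    have h1 := h (p.1, p.2.1.1) (by simp [plaquetteEdges])
    have h2 := h (p.1 + Pi.single p.2.1.1 1, p.2.1.2) (by simp [plaquetteEdges])
    have h3 := h (p.1 + Pi.single p.2.1.2 1, p.2.1.1) (by simp [plaquetteEdges])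
    have h4 := h (p.1, p.2.1.2) (by simp [plaquetteEdges])
    rw [← plaquetteObs_one r p.1 p.2.1.1 p.2.1.2]
    simp only [plaquetteObs, plaquetteHolonomyZd, h1, h2, h3, h4]

/-- **Identity exterior ⇒ flat density at EVERY site.**  In every ground state of the cube `(c, b)` with the identity exterior the
action density at any site `x` of `ℤ⁴` (boundary layer and exterior included) equals its flat value `dens x 1` — the depth-free form
of the disprover's `dens_eq_dens_one_of_mem_cubeMinimisers_one`. [folklore] -/
theorem dens_eq_dens_one_of_mem_cubeMinimisers_one_all {c : Fin 4 → ℤ} {b : ℕ} (x : Fin 4 → ℤ)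
    {ζ : ↥(cubeEdges c b) → G} (hζ : ζ ∈ cubeMinimisers G r c b 1) :
    dens G r x (glueWith (cubeEdges c b) ζ 1) = dens G r x 1 := by
  show actionDensity r.ρ (configShift (-x) (glueWith (cubeEdges c b) ζ 1)) = actionDensity r.ρ (configShift (-x) 1)
  unfold actionDensity
  refine Finset.sum_congr rfl fun i _ => Finset.sum_congr rfl fun j _ => ?_
  by_cases hij : i < j
  · simp only [hij, if_true]
    have h1 : plane G r (i, j) x (glueWith (cubeEdges c b) ζ 1) = r.N := by
      rw [plane_eq_plaquetteObs G r]
      exact plaquetteObs_eq_N_of_isMinOn_one_all r (fun ζ' => hζ ζ') ((x, ⟨(i, j), hij⟩) : ZdPlaquette 4)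
    unfold plane at h1
    rw [h1, configShift_one, plaquetteObs_one]
  · simp only [hij, if_false]

/-! ## §2 The identity-exterior references at every site -/

/-- `kerE_β^{1}(dens_x) → 6N` for EVERY site `x` (no depth hypothesis). [folklore] -/
theorem tendsto_kerE_one_dens_all (c : Fin 4 → ℤ) (b : ℕ) (x : Fin 4 → ℤ) :
    Tendsto (fun β : ℝ => kerE G r β c b 1 (dens G r x)) atTop (𝓝 (6 * (r.N : ℝ))) :=
  tendsto_kerE_of_eq_on_cubeMinimisers r c b 1 (continuous_dens r x) fun ζ hζ => by
    rw [dens_eq_dens_one_of_mem_cubeMinimisers_one_all r x hζ, dens_one]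

/-- `kerE_β^{1}(dens_x · dens_y) → (6N)²` for every two sites. [folklore] -/
theorem tendsto_kerE_one_dens_mul_all (c : Fin 4 → ℤ) (b : ℕ) (x y : Fin 4 → ℤ) :
    Tendsto (fun β : ℝ => kerE G r β c b 1 (fun U => dens G r x U * dens G r y U)) atTop
      (𝓝 (6 * (r.N : ℝ) * (6 * (r.N : ℝ)))) :=
  tendsto_kerE_of_eq_on_cubeMinimisers r c b 1 ((continuous_dens r x).mul (continuous_dens r y)) fun ζ hζ => by
    show dens G r x _ * dens G r y _ = _
    rw [dens_eq_dens_one_of_mem_cubeMinimisers_one_all r x hζ, dens_eq_dens_one_of_mem_cubeMinimisers_one_all r y hζ, dens_one r x,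
      dens_one r y]

/-- **`kerCov_β^{1}(dens_x, dens_y) → 0` for every two sites**: the identity exterior has a unique (flat) classical value everywhere,
so its zero-temperature conditional covariance vanishes on the boundary layer too. [folklore] -/
theorem tendsto_kerCov_one_dens_all (c : Fin 4 → ℤ) (b : ℕ) (x y : Fin 4 → ℤ) :
    Tendsto (fun β : ℝ => kerCov G r β c b 1 (dens G r x) (dens G r y)) atTop (𝓝 0) := by
  have h := (tendsto_kerE_one_dens_mul_all r c b x y).sub ((tendsto_kerE_one_dens_all r c b x).mul (tendsto_kerE_one_dens_all r c b y))
  rw [sub_self] at h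
  exact h

/-- `kerE_β^{1}(dens_x · dens_y · dens_z) → (6N)³` for every three sites. [folklore] -/
theorem tendsto_kerE_one_dens_mul_mul_all (c : Fin 4 → ℤ) (b : ℕ) (x y z : Fin 4 → ℤ) :
    Tendsto (fun β : ℝ => kerE G r β c b 1 (fun U => dens G r x U * dens G r y U * dens G r z U)) atTop
      (𝓝 (6 * (r.N : ℝ) * (6 * (r.N : ℝ)) * (6 * (r.N : ℝ)))) :=
  tendsto_kerE_of_eq_on_cubeMinimisers r c b 1 (((continuous_dens r x).mul (continuous_dens r y)).mul (continuous_dens r z))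
    fun ζ hζ => by
      show dens G r x _ * dens G r y _ * dens G r z _ = _
      rw [dens_eq_dens_one_of_mem_cubeMinimisers_one_all r x hζ, dens_eq_dens_one_of_mem_cubeMinimisers_one_all r y hζ,
        dens_eq_dens_one_of_mem_cubeMinimisers_one_all r z hζ, dens_one r x, dens_one r y, dens_one r z]

/-- **`kerK3_β^{1}(x, y, z) → 0` for every three sites.** [folklore] -/
theorem tendsto_kerK3_one_all (c : Fin 4 → ℤ) (b : ℕ) (x y z : Fin 4 → ℤ) :
    Tendsto (fun β : ℝ => kerK3 G r β c b 1 x y z) atTop (𝓝 0) := by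
  have hx1 := tendsto_kerE_one_dens_all r c b x
  have hy1 := tendsto_kerE_one_dens_all r c b y
  have hz1 := tendsto_kerE_one_dens_all r c b z
  have hxy := tendsto_kerE_one_dens_mul_all r c b x y
  have hxz := tendsto_kerE_one_dens_mul_all r c b x z
  have hyz := tendsto_kerE_one_dens_mul_all r c b y z
  have hxyz := tendsto_kerE_one_dens_mul_mul_all r c b x y z
  have h := (((hxyz.sub (hx1.mul hyz)).sub (hy1.mul hxz)).sub (hz1.mul hxy)).add
    ((hx1.mul hy1).mul hz1 |>.const_mul 2)
  have e : 6 * (r.N : ℝ) * (6 * (r.N : ℝ)) * (6 * (r.N : ℝ)) - 6 * (r.N : ℝ) * (6 * (r.N : ℝ) * (6 * (r.N : ℝ))) -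
      6 * (r.N : ℝ) * (6 * (r.N : ℝ) * (6 * (r.N : ℝ))) - 6 * (r.N : ℝ) * (6 * (r.N : ℝ) * (6 * (r.N : ℝ))) +
      2 * (6 * (r.N : ℝ) * (6 * (r.N : ℝ)) * (6 * (r.N : ℝ))) = 0 := by ring
  rw [e] at h
  refine h.congr' (Eventually.of_forall fun β => ?_)
  simp only [kerK3]

/-! ## §3 Clauses 2–3 at `β = ∞` on the boundary layer -/

section Clauses

variable (a : ℝ → ℝ)

/-- **Clause 2 caps the zero-temperature conditional covariance of EVERY exterior at EVERY pair of cube sites** (depth `≥ 1`, the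
registered typing): for every `e > 0`, eventually in `β`, `|kerCov_β^η(dens_x, dens_y)| ≤ C₂ / min(d_x, d_y)⁴ / (1 + ‖y − x‖)⁴ + e`.
[folklore] -/
theorem zeroTemp_kerCov_le_of_e2osc_depthOne (ha0 : Tendsto a atTop (𝓝 0)) {C₂ ℓ : ℝ} (hℓ : 0 < ℓ)
    (hE2 : ∃ β₂ : ℝ, ∀ β : ℝ, β₂ ≤ β → ∀ (c : Fin 4 → ℤ) (b : ℕ), (b : ℝ) * a β ≤ ℓ →
      ∀ (η η' : LGConfig 4 G) (x y : Fin 4 → ℤ), 1 ≤ depth c b x → 1 ≤ depth c b y →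
        |kerCov G r β c b η (dens G r x) (dens G r y) - kerCov G r β c b η' (dens G r x) (dens G r y)| ≤
          C₂ / ((min (depth c b x) (depth c b y) : ℕ) : ℝ) ^ 4 / (1 + ‖siteToE (y - x)‖) ^ 4)
    (c : Fin 4 → ℤ) (b : ℕ) {x y : Fin 4 → ℤ} (hx : 1 ≤ depth c b x) (hy : 1 ≤ depth c b y) (η : LGConfig 4 G)
    {e : ℝ} (he : 0 < e) :
    ∀ᶠ β : ℝ in atTop, |kerCov G r β c b η (dens G r x) (dens G r y)| ≤
      C₂ / ((min (depth c b x) (depth c b y) : ℕ) : ℝ) ^ 4 / (1 + ‖siteToE (y - x)‖) ^ 4 + e := by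
  obtain ⟨β₂, H2⟩ := hE2
  have h0 : ∀ᶠ β : ℝ in atTop, |kerCov G r β c b 1 (dens G r x) (dens G r y)| ≤ e := by
    have h := (tendsto_kerCov_one_dens_all r c b x y).abs
    rw [abs_zero] at h
    exact (h.eventually (eventually_le_nhds he)).mono fun _ h => h
  filter_upwards [h0, eventually_mul_le_of_tendsto_zero ha0 hℓ b, eventually_ge_atTop β₂] with β hβ0 hb hβ2
  have hosc := H2 β hβ2 c b hb η 1 x y hx hy
  have htri := abs_sub_abs_le_abs_sub (kerCov G r β c b η (dens G r x) (dens G r y)) (kerCov G r β c b 1 (dens G r x) (dens G r y))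
  linarith

/-- **Clause 3 caps the zero-temperature conditional third cumulant of EVERY exterior at EVERY triple of cube sites** (depth `≥ 1`).
[folklore] -/
theorem zeroTemp_kerK3_le_of_e3osc_depthOne (ha0 : Tendsto a atTop (𝓝 0)) {C₃ ℓ : ℝ} (hℓ : 0 < ℓ)
    (hE3 : ∃ β₃ : ℝ, ∀ β : ℝ, β₃ ≤ β → ∀ (c : Fin 4 → ℤ) (b : ℕ), (b : ℝ) * a β ≤ ℓ →
      ∀ (η η' : LGConfig 4 G) (x y z : Fin 4 → ℤ), 1 ≤ depth c b x → 1 ≤ depth c b y → 1 ≤ depth c b z →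
        |kerK3 G r β c b η x y z - kerK3 G r β c b η' x y z| ≤
          C₃ / ((min (min (depth c b x) (depth c b y)) (depth c b z) : ℕ) : ℝ) ^ 4 /
            (1 + min (min ‖siteToE (y - x)‖ ‖siteToE (z - y)‖) ‖siteToE (z - x)‖) ^ 8)
    (c : Fin 4 → ℤ) (b : ℕ) {x y z : Fin 4 → ℤ} (hx : 1 ≤ depth c b x) (hy : 1 ≤ depth c b y) (hz : 1 ≤ depth c b z)
    (η : LGConfig 4 G) {e : ℝ} (he : 0 < e) :
    ∀ᶠ β : ℝ in atTop, |kerK3 G r β c b η x y z| ≤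
      C₃ / ((min (min (depth c b x) (depth c b y)) (depth c b z) : ℕ) : ℝ) ^ 4 /
        (1 + min (min ‖siteToE (y - x)‖ ‖siteToE (z - y)‖) ‖siteToE (z - x)‖) ^ 8 + e := by
  obtain ⟨β₃, H3⟩ := hE3
  have h0 : ∀ᶠ β : ℝ in atTop, |kerK3 G r β c b 1 x y z| ≤ e := by
    have h := (tendsto_kerK3_one_all r c b x y z).abs
    rw [abs_zero] at h
    exact (h.eventually (eventually_le_nhds he)).mono fun _ h => h
  filter_upwards [h0, eventually_mul_le_of_tendsto_zero ha0 hℓ b, eventually_ge_atTop β₃] with β hβ0 hb hβ3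
  have hosc := H3 β hβ3 c b hb η 1 x y z hx hy hz
  have htri := abs_sub_abs_le_abs_sub (kerK3 G r β c b η x y z) (kerK3 G r β c b 1 x y z)
  linarith

end Clauses

/-! ## §4 The orbit test on the boundary layer -/

section OrbitDepthOne

variable (a : ℝ → ℝ) {ι : Type} [Fintype ι] [Nonempty ι]

/-- **Orbit test at `1 ≤ depth`: clause 2 prices a one-orbit degenerate box by the orbit covariance of its density field at ANY two
cube sites**, boundary layer included: `|M₁₂/k − (M₁/k)(M₂/k)| ≤ C₂ / min(d_x,d_y)⁴ / (1 + ‖y − x‖)⁴`. [folklore] -/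
theorem orbitCov_le_of_e2osc_depthOne (ha0 : Tendsto a atTop (𝓝 0)) {C₂ ℓ : ℝ} (hℓ : 0 < ℓ)
    (hE2 : ∃ β₂ : ℝ, ∀ β : ℝ, β₂ ≤ β → ∀ (c : Fin 4 → ℤ) (b : ℕ), (b : ℝ) * a β ≤ ℓ →
      ∀ (η η' : LGConfig 4 G) (x y : Fin 4 → ℤ), 1 ≤ depth c b x → 1 ≤ depth c b y →
        |kerCov G r β c b η (dens G r x) (dens G r y) - kerCov G r β c b η' (dens G r x) (dens G r y)| ≤
          C₂ / ((min (depth c b x) (depth c b y) : ℕ) : ℝ) ^ 4 / (1 + ‖siteToE (y - x)‖) ^ 4)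
    (c : Fin 4 → ℤ) (b : ℕ) (η : LGConfig 4 G) (γ : ι → LGConfig 4 G → LGConfig 4 G) (hγ : ∀ i, Continuous (γ i))
    {x y : Fin 4 → ℤ} (hx : 1 ≤ depth c b x) (hy : 1 ≤ depth c b y) {M₁ M₂ M₁₂ : ℝ}
    (h₁ : ∀ ζ ∈ cubeMinimisers G r c b η, ∑ i, dens G r x (γ i (glueWith (cubeEdges c b) ζ η)) = M₁)
    (h₂ : ∀ ζ ∈ cubeMinimisers G r c b η, ∑ i, dens G r y (γ i (glueWith (cubeEdges c b) ζ η)) = M₂)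
    (h₁₂ : ∀ ζ ∈ cubeMinimisers G r c b η,
      ∑ i, dens G r x (γ i (glueWith (cubeEdges c b) ζ η)) * dens G r y (γ i (glueWith (cubeEdges c b) ζ η)) = M₁₂)
    (s₁ : ∀ (β : ℝ) (i : ι), kerE G r β c b η (dens G r x ∘ γ i) = kerE G r β c b η (dens G r x))
    (s₂ : ∀ (β : ℝ) (i : ι), kerE G r β c b η (dens G r y ∘ γ i) = kerE G r β c b η (dens G r y))
    (s₁₂ : ∀ (β : ℝ) (i : ι), kerE G r β c b η ((fun U => dens G r x U * dens G r y U) ∘ γ i) =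
      kerE G r β c b η (fun U => dens G r x U * dens G r y U)) :
    |M₁₂ / Fintype.card ι - M₁ / Fintype.card ι * (M₂ / Fintype.card ι)| ≤
      C₂ / ((min (depth c b x) (depth c b y) : ℕ) : ℝ) ^ 4 / (1 + ‖siteToE (y - x)‖) ^ 4 := by
  obtain ⟨β₂, H2⟩ := hE2
  have hlim : Tendsto (fun β : ℝ => |kerCov G r β c b η (dens G r x) (dens G r y) - kerCov G r β c b 1 (dens G r x) (dens G r y)|)
      atTop (𝓝 |M₁₂ / Fintype.card ι - M₁ / Fintype.card ι * (M₂ / Fintype.card ι)|) := by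
    have h := ((tendsto_kerCov_of_orbit r c b η γ hγ h₁ h₂ h₁₂ s₁ s₂ s₁₂).sub (tendsto_kerCov_one_dens_all r c b x y)).abs
    rwa [sub_zero] at h
  refine le_of_tendsto hlim ?_
  filter_upwards [eventually_mul_le_of_tendsto_zero ha0 hℓ b, eventually_ge_atTop β₂] with β hb hβ2
  exact H2 β hβ2 c b hb η 1 x y hx hy

/-- **Orbit test at `1 ≤ depth`, diagonal**: the orbit VARIANCE of the density at any cube site is `≤ C₂/d⁴`. [folklore] -/
theorem orbitVar_le_of_e2osc_depthOne (ha0 : Tendsto a atTop (𝓝 0)) {C₂ ℓ : ℝ} (hℓ : 0 < ℓ)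
    (hE2 : ∃ β₂ : ℝ, ∀ β : ℝ, β₂ ≤ β → ∀ (c : Fin 4 → ℤ) (b : ℕ), (b : ℝ) * a β ≤ ℓ →
      ∀ (η η' : LGConfig 4 G) (x y : Fin 4 → ℤ), 1 ≤ depth c b x → 1 ≤ depth c b y →
        |kerCov G r β c b η (dens G r x) (dens G r y) - kerCov G r β c b η' (dens G r x) (dens G r y)| ≤
          C₂ / ((min (depth c b x) (depth c b y) : ℕ) : ℝ) ^ 4 / (1 + ‖siteToE (y - x)‖) ^ 4)
    (c : Fin 4 → ℤ) (b : ℕ) (η : LGConfig 4 G) (γ : ι → LGConfig 4 G → LGConfig 4 G) (hγ : ∀ i, Continuous (γ i))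
    {x : Fin 4 → ℤ} (hx : 1 ≤ depth c b x) {M₁ M₁₁ : ℝ}
    (h₁ : ∀ ζ ∈ cubeMinimisers G r c b η, ∑ i, dens G r x (γ i (glueWith (cubeEdges c b) ζ η)) = M₁)
    (h₁₁ : ∀ ζ ∈ cubeMinimisers G r c b η,
      ∑ i, dens G r x (γ i (glueWith (cubeEdges c b) ζ η)) * dens G r x (γ i (glueWith (cubeEdges c b) ζ η)) = M₁₁)
    (s₁ : ∀ (β : ℝ) (i : ι), kerE G r β c b η (dens G r x ∘ γ i) = kerE G r β c b η (dens G r x))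
    (s₁₁ : ∀ (β : ℝ) (i : ι), kerE G r β c b η ((fun U => dens G r x U * dens G r x U) ∘ γ i) =
      kerE G r β c b η (fun U => dens G r x U * dens G r x U)) :
    M₁₁ / Fintype.card ι - (M₁ / Fintype.card ι) ^ 2 ≤ C₂ / (depth c b x : ℝ) ^ 4 := by
  have h := orbitCov_le_of_e2osc_depthOne r a ha0 hℓ hE2 c b η γ hγ hx hx h₁ h₁ h₁₁ s₁ s₁ s₁₁
  have h0 : ‖siteToE (x - x)‖ = 0 := by
    rw [sub_self, show siteToE (0 : Site 4) = 0 from by ext j; simp [siteToE_apply], norm_zero]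
  rw [min_self, h0, add_zero, one_pow, div_one] at h
  rw [sq]
  exact (le_abs_self _).trans h

/-- **Orbit test at `1 ≤ depth`, clause 1**: the orbit-MEAN deficit at any cube site is `≤ C₁/d⁴`: `6N − M₁/k ≤ C₁/d_x⁴`. [folklore] -/
theorem orbitMean_deficit_le_of_e1osc_depthOne (ha0 : Tendsto a atTop (𝓝 0)) {C₁ ℓ : ℝ} (hℓ : 0 < ℓ)
    (hE1 : ∃ β₁ : ℝ, ∀ β : ℝ, β₁ ≤ β → ∀ (c : Fin 4 → ℤ) (b : ℕ), (b : ℝ) * a β ≤ ℓ →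
      ∀ (η η' : LGConfig 4 G) (x : Fin 4 → ℤ), 1 ≤ depth c b x →
        |kerE G r β c b η (dens G r x) - kerE G r β c b η' (dens G r x)| ≤ C₁ / (depth c b x : ℝ) ^ 4)
    (c : Fin 4 → ℤ) (b : ℕ) (η : LGConfig 4 G) (γ : ι → LGConfig 4 G → LGConfig 4 G) (hγ : ∀ i, Continuous (γ i))
    {x : Fin 4 → ℤ} (hx : 1 ≤ depth c b x) {M₁ : ℝ}
    (h₁ : ∀ ζ ∈ cubeMinimisers G r c b η, ∑ i, dens G r x (γ i (glueWith (cubeEdges c b) ζ η)) = M₁)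
    (s₁ : ∀ (β : ℝ) (i : ι), kerE G r β c b η (dens G r x ∘ γ i) = kerE G r β c b η (dens G r x)) :
    6 * (r.N : ℝ) - M₁ / Fintype.card ι ≤ C₁ / (depth c b x : ℝ) ^ 4 := by
  obtain ⟨β₁, H1⟩ := hE1
  have hlim : Tendsto (fun β : ℝ => kerE G r β c b 1 (dens G r x) - kerE G r β c b η (dens G r x)) atTop
      (𝓝 (6 * (r.N : ℝ) - M₁ / Fintype.card ι)) :=
    (tendsto_kerE_one_dens_all r c b x).sub (tendsto_kerE_of_orbit r c b η γ (fun i => (continuous_dens r x).comp (hγ i)) h₁ s₁)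
  refine le_of_tendsto hlim ?_
  filter_upwards [eventually_mul_le_of_tendsto_zero ha0 hℓ b, eventually_ge_atTop β₁] with β hb hβ1
  exact (le_abs_self _).trans (H1 β hβ1 c b hb 1 η x hx)

end OrbitDepthOne

end Summit.QuantumFields.YangMills.Cruxes.NT.ClassicalShadow

end
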